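import Summits.ABC.StewartYu.ArchG3Functions
import HarnessLib

/-!
# Cell abc-stewartyu, rung A1.L (crux r2 `ArchCoreRat`), parcel WP-L.A P-A4: the values of the exact class functions `φ_τ` at the
# HALF-INTEGER points `s/2` (the input of the Kummer half-step, P-A6)

`Summits/ABC/StewartYu/ArchG3HalfPoint.lean` — small sequel to `ArchG3Functions` (cell `abc-stewartyu`, seat p5-g7).  Theorems on
`ArchG3Setup`; no named fact.  Print's half-step (Nesterenko 2003 §4.3, (4.36)–(4.45)) evaluates `Φ_s(ζ, μ)` at `ζ = y + ½`: the
`Y₀`-weight is a rational number (`hw_eval_ratCast`), the directional factor is unchanged, and the exponential becomes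
`exp(Lsum(vᵢ)·s/2) = √(∏ⱼ αⱼ^{vᵢⱼ s})` — a positive real quadratic irrationality whose square is the rational monomial at the INTEGER
point `s = 2y+1` (so the P-A6 seat splits it by square classes, `PadicG3HalfSplit`-style, and closes with the multiquadratic Liouville
inequality `Waldschmidt1980Liouville.abs_ev_ge_sharp`).  This file records exactly that identity:

* `exp_Lsum_mul_half` (`exp(Lsum w · s/2) = √(∏ αⱼ^{wⱼ s})`, real), `exp_Lc_mul_half` (the same in `ℂ`);
* `archTermΦ_half`, **`archΦ_half`**: `φ_τ(s/2) = Σᵢ pᵢ · (Hasse_{t₀}Rᵢ)(s/2) · zγpow · √(∏ⱼ αⱼ^{vᵢⱼ s})` (cast to `ℂ`).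

WHAT THIS IS NOT: no square-class splitting, no separation inequality, no descent (P-A6); no crux moves.

References: Yu. V. Nesterenko, LNM 1819 (2003), §4.3 (4.36)–(4.38), (4.42)–(4.45).
-/

noncomputable section

open Finset Polynomial
open Literature.NumberTheory.Transcendental
open Literature.NumberTheory.Transcendental.CW77.Setup (Tau)
open scoped Nat

namespace Summit.ABC.StewartYu

namespace ArchG3Setup

variable (S : ArchG3Setup) {ι : Type*} (R : ι → ℚ[X]) (v : ι → Fin S.n → ℤ)

/-- **`exp(Lsum w · s/2) = √(∏ⱼ αⱼ^{wⱼ s})`** for an integer `s` (the positive square root of the rational monomial at `s`).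
[cite: Nesterenko2003, §4.3 (4.42)] -/
theorem exp_Lsum_mul_half (w : Fin S.n → ℤ) (s : ℤ) :
    Real.exp (S.Lsum w * ((s : ℝ) / 2)) = Real.sqrt (((∏ j, S.α j ^ (w j * s) : ℚ)) : ℝ) := by
  rw [← S.exp_intCast_mul_Lsum w s, ← Real.exp_half]
  congr 1
  ring

/-- The same identity in `ℂ`: `exp(Lc w · s/2) = √(∏ⱼ αⱼ^{wⱼ s})` (a real number, cast). [cite: Nesterenko2003, §4.3 (4.42)] -/
theorem exp_Lc_mul_half (w : Fin S.n → ℤ) (s : ℤ) :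
    Complex.exp (S.Lc w * ((s : ℂ) / 2)) = ((Real.sqrt (((∏ j, S.α j ^ (w j * s) : ℚ)) : ℝ) : ℝ) : ℂ) := by
  rw [← S.exp_Lsum_mul_half, Complex.ofReal_exp]
  unfold Lc
  push_cast
  ring_nf

/-- One term of `φ_τ` at the half-integer `s/2`. [cite: Nesterenko2003, §4.3 (4.37)–(4.38)] -/
theorem archTermΦ_half (i : ι) (τ : Tau S.n) (s : ℤ) :
    S.archTermΦ R v i τ (((s : ℚ) / 2 : ℚ) : ℂ) =
      (((hasseDeriv τ.1 (R i)).eval ((s : ℚ) / 2) * S.zγpow v i τ.2 : ℚ) : ℂ) *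
        ((Real.sqrt (((∏ j, S.α j ^ (v i j * s) : ℚ)) : ℝ) : ℝ) : ℂ) := by
  unfold archTermΦ
  rw [hw_eval_ratCast]
  have hz : (((s : ℚ) / 2 : ℚ) : ℂ) = (s : ℂ) / 2 := by push_cast; ring
  rw [hz, S.exp_Lc_mul_half]
  push_cast
  ring

/-- **`φ_τ(s/2) = Σᵢ pᵢ · (Hasse_{t₀}Rᵢ)(s/2) · zγpow · √(∏ⱼ αⱼ^{vᵢⱼ s})`** — the value of the exact class function at a half-integer:
rational data times the positive square roots of the rational monomials at the odd integer `s`. [cite: Nesterenko2003, §4.3 (4.37)–(4.38), (4.42)] -/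
theorem archΦ_half (B : Finset ι) (pv : ι → ℤ) (τ : Tau S.n) (s : ℤ) :
    S.archΦ R v B pv τ (((s : ℚ) / 2 : ℚ) : ℂ) =
      ∑ i ∈ B, ((pv i : ℚ) : ℂ) * ((((hasseDeriv τ.1 (R i)).eval ((s : ℚ) / 2) * S.zγpow v i τ.2 : ℚ) : ℂ) *
        ((Real.sqrt (((∏ j, S.α j ^ (v i j * s) : ℚ)) : ℝ) : ℝ) : ℂ)) := by
  unfold archΦ
  refine sum_congr rfl fun i _ => ?_
  rw [S.archTermΦ_half]
  push_cast
  ring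

/-- The square of the half-point exponential is the rational monomial at `s`: `(√(∏ αⱼ^{wⱼ s}))² = ∏ αⱼ^{wⱼ s}`. [folklore] -/
theorem sq_sqrt_prod_zpow (w : Fin S.n → ℤ) (s : ℤ) :
    Real.sqrt (((∏ j, S.α j ^ (w j * s) : ℚ)) : ℝ) ^ 2 = (((∏ j, S.α j ^ (w j * s) : ℚ)) : ℝ) :=
  Real.sq_sqrt (by exact_mod_cast (S.prod_zpow_pos_rat _).le)

end ArchG3Setup

end Summit.ABC.StewartYu

end
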